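import Summits.Ventures.PercRepro.Night2SevenFiveResidues

/-!
# PercRepro — the cells `(q − 1, q − 3)` at `q = 6, 7, 8` (night-2, gen 20)

The regime `|E ∖ G| = q − 1`, `kColoops = q − 3` (`ρ = 4`, two top levels) was typed at general `q` by gen 19
(`localShadowHall_dgenP_of_sum`) and closed at `q = 5` (`localShadowHall_four_two_five`); the crude size-only sum
`ρ λ C(n, 4) ≤ c′ A(n) + T(n)` holds for every `n` at `q = 6, 7, 8` as well (gen 19 §1 recorded the ratios 1.118 /
1.070 / 1.030; it fails from `q = 9`, where the per-basis bound of `Night2ExcessGeneralQ` takes over).  Here the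
three inequalities are proved (`11 C(n,4) ≤ 5 A + 49 T`, `46 C(n,4) ≤ 17 A + 224 T`, `61 C(n,4) ≤ 19 A + 324 T`:
bounded ranges by kernel evaluation through `Σ_{i ≤ 4} C(n,i) + A + T = 2^n`, growth from the two middle binomials)
and the cells **`localShadowHall_five_three_six`**, **`localShadowHall_six_four_seven`**,
**`localShadowHall_seven_five_eight`** follow — the first cells of the rows `q = 6, 7, 8` beyond the rigid cell.
-/

namespace PercRepro.Shadow

open Finset PerFlat ThmH

namespace DGenP

/-! ## `q = 6`: the cell `(5, 3)` -/

/-- `c′ = 5/49` at `(q, d, ρ, k, m₁) = (6, 5, 4, 3, 2)`. -/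
theorem cPrimeDGP_five_three_six : cPrimeDGP 6 5 4 3 2 = 5 / 49 := by
  unfold cPrimeDGP capDG reqDGP phiQ; norm_num

/-- `λ = 11/196` at `(q, d, ρ, k) = (6, 5, 4, 3)`. -/
theorem lambdaDG_five_three_six : lambdaDG 6 5 4 3 = 11 / 196 := by
  unfold lambdaDG capDG reqDG phiQ; norm_num

/-- `5 (C(n, 5) + C(n, 6)) ≥ 11 C(n, 4)` for `n ≥ 10`. -/
theorem five_three_six_growth {n : ℕ} (hn : 10 ≤ n) : 11 * n.choose 4 ≤ 5 * (n.choose 5 + n.choose 6) := by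
  obtain ⟨m, rfl⟩ : ∃ m, n = m + 10 := ⟨n - 10, by omega⟩
  have h5 := Nat.choose_succ_right_eq (m + 10) 4
  have h6 := Nat.choose_succ_right_eq (m + 10) 5
  rw [show m + 10 - 4 = m + 6 by omega] at h5
  rw [show m + 10 - 5 = m + 5 by omega] at h6
  have l5 : 6 * (m + 10).choose 4 ≤ 5 * (m + 10).choose 5 := by
    nlinarith [h5, Nat.zero_le ((m + 10).choose 4 * m)]
  have l6 : 5 * (m + 10).choose 5 ≤ 6 * (m + 10).choose 6 := by
    nlinarith [h6, Nat.zero_le ((m + 10).choose 5 * m)]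
  omega

/-- The bounded range `6 ≤ n ≤ 9` of the `(5, 3)` inequality at `q = 6`. -/
theorem five_three_six_ineq_small {n : ℕ} (hn : 6 ≤ n) (hn' : n ≤ 9) :
    11 * n.choose 4 ≤ 5 * DGen.Aρt n 4 2 + 49 * DGen.Ttop n 2 := by
  have hid : (∑ i ∈ Finset.range 5, n.choose i) + DGen.Aρt n 4 2 + DGen.Ttop n 2 = 2 ^ n :=
    DGen.sum_range_add_Aρt_add_Ttop (by omega)
  have key : 11 * n.choose 4 + 5 * (∑ i ∈ Finset.range 5, n.choose i) ≤ 5 * 2 ^ n + 44 * DGen.Ttop n 2 := by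
    unfold DGen.Ttop
    interval_cases n <;> decide
  omega

/-- **The `(5, 3)` inequality at `q = 6`** `11 C(n, 4) ≤ 5 A + 49 T` for every `n ≥ 6`. -/
theorem five_three_six_ineq {n : ℕ} (hn : 6 ≤ n) : 11 * n.choose 4 ≤ 5 * DGen.Aρt n 4 2 + 49 * DGen.Ttop n 2 := by
  by_cases h : n ≤ 9
  · exact five_three_six_ineq_small hn h
  · push Not at h
    have hA : n.choose 5 + n.choose 6 ≤ DGen.Aρt n 4 2 := DGen.Aρt_ge_two (by omega)
    have h2 := five_three_six_growth (by omega : 10 ≤ n)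
    omega

/-- The crude target sum of the cell `(5, 3)` at `q = 6` is at least `1` for every `n ≥ 6`. -/
theorem one_le_genSum_five_three_six {n : ℕ} (hn : 6 ≤ n) :
    1 ≤ genSum n 4 2 (cPrimeDGP 6 5 4 3 2) (lambdaDG 6 5 4 3) := by
  rw [cPrimeDGP_five_three_six, lambdaDG_five_three_six, genSum_eq (by omega) (by norm_num) (by norm_num)]
  have hC : (0 : ℚ) < (n.choose 4 : ℚ) := by exact_mod_cast Nat.choose_pos (by omega)
  rw [le_div_iff₀ (by positivity)]
  have key' : (11 : ℚ) * (n.choose 4 : ℚ) ≤ 5 * (DGen.Aρt n 4 2 : ℚ) + 49 * (DGen.Ttop n 2 : ℚ) := by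
    exact_mod_cast five_three_six_ineq hn
  norm_num
  linarith

/-! ## `q = 7`: the cell `(6, 4)` -/

/-- `c′ = 17/224` at `(q, d, ρ, k, m₁) = (7, 6, 4, 4, 2)`. -/
theorem cPrimeDGP_six_four_seven : cPrimeDGP 7 6 4 4 2 = 17 / 224 := by
  unfold cPrimeDGP capDG reqDGP phiQ; norm_num

/-- `λ = 23/448` at `(q, d, ρ, k) = (7, 6, 4, 4)`. -/
theorem lambdaDG_six_four_seven : lambdaDG 7 6 4 4 = 23 / 448 := by
  unfold lambdaDG capDG reqDG phiQ; norm_num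

/-- `17 (C(n, 5) + C(n, 6)) ≥ 46 C(n, 4)` for `n ≥ 11`. -/
theorem six_four_seven_growth {n : ℕ} (hn : 11 ≤ n) : 46 * n.choose 4 ≤ 17 * (n.choose 5 + n.choose 6) := by
  obtain ⟨m, rfl⟩ : ∃ m, n = m + 11 := ⟨n - 11, by omega⟩
  have h5 := Nat.choose_succ_right_eq (m + 11) 4
  have h6 := Nat.choose_succ_right_eq (m + 11) 5
  rw [show m + 11 - 4 = m + 7 by omega] at h5
  rw [show m + 11 - 5 = m + 6 by omega] at h6
  have l5 : 7 * (m + 11).choose 4 ≤ 5 * (m + 11).choose 5 := by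
    nlinarith [h5, Nat.zero_le ((m + 11).choose 4 * m)]
  have l6 : 6 * (m + 11).choose 5 ≤ 6 * (m + 11).choose 6 := by
    nlinarith [h6, Nat.zero_le ((m + 11).choose 5 * m)]
  omega

/-- The bounded range `6 ≤ n ≤ 10` of the `(6, 4)` inequality at `q = 7`. -/
theorem six_four_seven_ineq_small {n : ℕ} (hn : 6 ≤ n) (hn' : n ≤ 10) :
    46 * n.choose 4 ≤ 17 * DGen.Aρt n 4 2 + 224 * DGen.Ttop n 2 := by
  have hid : (∑ i ∈ Finset.range 5, n.choose i) + DGen.Aρt n 4 2 + DGen.Ttop n 2 = 2 ^ n :=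
    DGen.sum_range_add_Aρt_add_Ttop (by omega)
  have key : 46 * n.choose 4 + 17 * (∑ i ∈ Finset.range 5, n.choose i) ≤ 17 * 2 ^ n + 207 * DGen.Ttop n 2 := by
    unfold DGen.Ttop
    interval_cases n <;> decide
  omega

/-- **The `(6, 4)` inequality at `q = 7`** `46 C(n, 4) ≤ 17 A + 224 T` for every `n ≥ 6`. -/
theorem six_four_seven_ineq {n : ℕ} (hn : 6 ≤ n) : 46 * n.choose 4 ≤ 17 * DGen.Aρt n 4 2 + 224 * DGen.Ttop n 2 := by
  by_cases h : n ≤ 10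
  · exact six_four_seven_ineq_small hn h
  · push Not at h
    have hA : n.choose 5 + n.choose 6 ≤ DGen.Aρt n 4 2 := DGen.Aρt_ge_two (by omega)
    have h2 := six_four_seven_growth (by omega : 11 ≤ n)
    omega

/-- The crude target sum of the cell `(6, 4)` at `q = 7` is at least `1` for every `n ≥ 6`. -/
theorem one_le_genSum_six_four_seven {n : ℕ} (hn : 6 ≤ n) :
    1 ≤ genSum n 4 2 (cPrimeDGP 7 6 4 4 2) (lambdaDG 7 6 4 4) := by
  rw [cPrimeDGP_six_four_seven, lambdaDG_six_four_seven, genSum_eq (by omega) (by norm_num) (by norm_num)]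
  have hC : (0 : ℚ) < (n.choose 4 : ℚ) := by exact_mod_cast Nat.choose_pos (by omega)
  rw [le_div_iff₀ (by positivity)]
  have key' : (46 : ℚ) * (n.choose 4 : ℚ) ≤ 17 * (DGen.Aρt n 4 2 : ℚ) + 224 * (DGen.Ttop n 2 : ℚ) := by
    exact_mod_cast six_four_seven_ineq hn
  norm_num
  linarith

/-! ## `q = 8`: the cell `(7, 5)` -/

/-- `c′ = 19/324` at `(q, d, ρ, k, m₁) = (8, 7, 4, 5, 2)`. -/
theorem cPrimeDGP_seven_five_eight : cPrimeDGP 8 7 4 5 2 = 19 / 324 := by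
  unfold cPrimeDGP capDG reqDGP phiQ; norm_num

/-- `λ = 61/1296` at `(q, d, ρ, k) = (8, 7, 4, 5)`. -/
theorem lambdaDG_seven_five_eight : lambdaDG 8 7 4 5 = 61 / 1296 := by
  unfold lambdaDG capDG reqDG phiQ; norm_num

/-- `19 (C(n, 5) + C(n, 6)) ≥ 61 C(n, 4)` for `n ≥ 12`. -/
theorem seven_five_eight_growth {n : ℕ} (hn : 12 ≤ n) : 61 * n.choose 4 ≤ 19 * (n.choose 5 + n.choose 6) := by
  obtain ⟨m, rfl⟩ : ∃ m, n = m + 12 := ⟨n - 12, by omega⟩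
  have h5 := Nat.choose_succ_right_eq (m + 12) 4
  have h6 := Nat.choose_succ_right_eq (m + 12) 5
  rw [show m + 12 - 4 = m + 8 by omega] at h5
  rw [show m + 12 - 5 = m + 7 by omega] at h6
  have l5 : 8 * (m + 12).choose 4 ≤ 5 * (m + 12).choose 5 := by
    nlinarith [h5, Nat.zero_le ((m + 12).choose 4 * m)]
  have l6 : 7 * (m + 12).choose 5 ≤ 6 * (m + 12).choose 6 := by
    nlinarith [h6, Nat.zero_le ((m + 12).choose 5 * m)]
  omega

/-- The bounded range `6 ≤ n ≤ 11` of the `(7, 5)` inequality at `q = 8`. -/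
theorem seven_five_eight_ineq_small {n : ℕ} (hn : 6 ≤ n) (hn' : n ≤ 11) :
    61 * n.choose 4 ≤ 19 * DGen.Aρt n 4 2 + 324 * DGen.Ttop n 2 := by
  have hid : (∑ i ∈ Finset.range 5, n.choose i) + DGen.Aρt n 4 2 + DGen.Ttop n 2 = 2 ^ n :=
    DGen.sum_range_add_Aρt_add_Ttop (by omega)
  have key : 61 * n.choose 4 + 19 * (∑ i ∈ Finset.range 5, n.choose i) ≤ 19 * 2 ^ n + 305 * DGen.Ttop n 2 := by
    unfold DGen.Ttop
    interval_cases n <;> decide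
  omega

/-- **The `(7, 5)` inequality at `q = 8`** `61 C(n, 4) ≤ 19 A + 324 T` for every `n ≥ 6`. -/
theorem seven_five_eight_ineq {n : ℕ} (hn : 6 ≤ n) : 61 * n.choose 4 ≤ 19 * DGen.Aρt n 4 2 + 324 * DGen.Ttop n 2 := by
  by_cases h : n ≤ 11
  · exact seven_five_eight_ineq_small hn h
  · push Not at h
    have hA : n.choose 5 + n.choose 6 ≤ DGen.Aρt n 4 2 := DGen.Aρt_ge_two (by omega)
    have h2 := seven_five_eight_growth (by omega : 12 ≤ n)
    omega

/-- The crude target sum of the cell `(7, 5)` at `q = 8` is at least `1` for every `n ≥ 6`. -/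
theorem one_le_genSum_seven_five_eight {n : ℕ} (hn : 6 ≤ n) :
    1 ≤ genSum n 4 2 (cPrimeDGP 8 7 4 5 2) (lambdaDG 8 7 4 5) := by
  rw [cPrimeDGP_seven_five_eight, lambdaDG_seven_five_eight, genSum_eq (by omega) (by norm_num) (by norm_num)]
  have hC : (0 : ℚ) < (n.choose 4 : ℚ) := by exact_mod_cast Nat.choose_pos (by omega)
  rw [le_div_iff₀ (by positivity)]
  have key' : (61 : ℚ) * (n.choose 4 : ℚ) ≤ 19 * (DGen.Aρt n 4 2 : ℚ) + 324 * (DGen.Ttop n 2 : ℚ) := by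
    exact_mod_cast seven_five_eight_ineq hn
  norm_num
  linarith

end DGenP

variable {α : Type*} [DecidableEq α] {M : Matroid α} [M.Finite]

open DGenP in
open scoped Classical in
/-- **THE CELL `(5, 3)` OF THE ROW `q = 6`**: (LI_G) at every rank-`7` flat `G` with `|E ∖ G| = 5` and `3` coloops
of `M|G` of a loopless simple matroid of rank `8`. -/
theorem localShadowHall_five_three_six {G : Finset α} (hG : G ∈ flatsQ M (6 + 1))
    (hd : (gr M \ G).card = 5) (hk : kColoops M G = 3)
    (hs : ∀ e ∈ gr M, ∀ f ∈ gr M, e ≠ f → rkN M {e, f} = 2) (hl : ∀ e ∈ gr M, M.Indep {e}) :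
    LocalShadowHall M 6 G := by
  have hk' : kColoops M G + 4 = 6 + 1 := by omega
  have hd' : (gr M \ G).card ≤ 6 := by omega
  have hm₁ : ∀ B ∈ thinMembers M 6 G, 4 ≤ (B \ coloops M G).card → 2 ≤ (G \ clF M B).card :=
    fun B hB _ => two_le_card_sdiff_of_not_lay0 hG hd' (mem_thinMembers.1 hB).1 (mem_thinMembers.1 hB).2
  by_cases hn : 6 ≤ G.card - kColoops M G
  · exact localShadowHall_dgenP_of_sum (d := 5) (ρ := 4) (m₁ := 2) hG hd (by norm_num) hk'
      (by norm_num) (by omega) hs hl (by rw [hk, DGenP.cPrimeDGP_five_three_six]; norm_num)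
      (by rw [hk, DGenP.lambdaDG_five_three_six]; norm_num) hm₁
      (by rw [hk] at hn ⊢; exact DGenP.one_le_genSum_five_three_six hn)
  · -- fewer than 6 points off the coloops: there is no thin member at all
    exact localShadowHall_of_lossFair hG hd'
      (fun B hB => absurd (thin_card_bound (ρ := 4) hG hd (by omega) hk' hB) (by omega))

open DGenP in
open scoped Classical in
/-- **THE CELL `(6, 4)` OF THE ROW `q = 7`**: (LI_G) at every rank-`8` flat `G` with `|E ∖ G| = 6` and `4` coloops
of `M|G` of a loopless simple matroid of rank `9`. -/
theorem localShadowHall_six_four_seven {G : Finset α} (hG : G ∈ flatsQ M (7 + 1))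
    (hd : (gr M \ G).card = 6) (hk : kColoops M G = 4)
    (hs : ∀ e ∈ gr M, ∀ f ∈ gr M, e ≠ f → rkN M {e, f} = 2) (hl : ∀ e ∈ gr M, M.Indep {e}) :
    LocalShadowHall M 7 G := by
  have hk' : kColoops M G + 4 = 7 + 1 := by omega
  have hd' : (gr M \ G).card ≤ 7 := by omega
  have hm₁ : ∀ B ∈ thinMembers M 7 G, 4 ≤ (B \ coloops M G).card → 2 ≤ (G \ clF M B).card :=
    fun B hB _ => two_le_card_sdiff_of_not_lay0 hG hd' (mem_thinMembers.1 hB).1 (mem_thinMembers.1 hB).2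
  by_cases hn : 6 ≤ G.card - kColoops M G
  · exact localShadowHall_dgenP_of_sum (d := 6) (ρ := 4) (m₁ := 2) hG hd (by norm_num) hk'
      (by norm_num) (by omega) hs hl (by rw [hk, DGenP.cPrimeDGP_six_four_seven]; norm_num)
      (by rw [hk, DGenP.lambdaDG_six_four_seven]; norm_num) hm₁
      (by rw [hk] at hn ⊢; exact DGenP.one_le_genSum_six_four_seven hn)
  · -- fewer than 6 points off the coloops: there is no thin member at all
    exact localShadowHall_of_lossFair hG hd'
      (fun B hB => absurd (thin_card_bound (ρ := 4) hG hd (by omega) hk' hB) (by omega))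

open DGenP in
open scoped Classical in
/-- **THE CELL `(7, 5)` OF THE ROW `q = 8`**: (LI_G) at every rank-`9` flat `G` with `|E ∖ G| = 7` and `5` coloops
of `M|G` of a loopless simple matroid of rank `10`. -/
theorem localShadowHall_seven_five_eight {G : Finset α} (hG : G ∈ flatsQ M (8 + 1))
    (hd : (gr M \ G).card = 7) (hk : kColoops M G = 5)
    (hs : ∀ e ∈ gr M, ∀ f ∈ gr M, e ≠ f → rkN M {e, f} = 2) (hl : ∀ e ∈ gr M, M.Indep {e}) :
    LocalShadowHall M 8 G := by
  have hk' : kColoops M G + 4 = 8 + 1 := by omega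
  have hd' : (gr M \ G).card ≤ 8 := by omega
  have hm₁ : ∀ B ∈ thinMembers M 8 G, 4 ≤ (B \ coloops M G).card → 2 ≤ (G \ clF M B).card :=
    fun B hB _ => two_le_card_sdiff_of_not_lay0 hG hd' (mem_thinMembers.1 hB).1 (mem_thinMembers.1 hB).2
  by_cases hn : 6 ≤ G.card - kColoops M G
  · exact localShadowHall_dgenP_of_sum (d := 7) (ρ := 4) (m₁ := 2) hG hd (by norm_num) hk'
      (by norm_num) (by omega) hs hl (by rw [hk, DGenP.cPrimeDGP_seven_five_eight]; norm_num)
      (by rw [hk, DGenP.lambdaDG_seven_five_eight]; norm_num) hm₁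
      (by rw [hk] at hn ⊢; exact DGenP.one_le_genSum_seven_five_eight hn)
  · -- fewer than 6 points off the coloops: there is no thin member at all
    exact localShadowHall_of_lossFair hG hd'
      (fun B hB => absurd (thin_card_bound (ρ := 4) hG hd (by omega) hk' hB) (by omega))

end PercRepro.Shadow
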